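import Literature.Analysis.FluidPDE.InfiniteHardSphereDynamics
import Literature.Analysis.FluidPDE.RootedLocalState
import Literature.Analysis.FunctionSpaces.PoissonPointProcessExistence
import Literature.Analysis.FunctionSpaces.LorentzGas
import Literature.MathematicalPhysics.KineticTheory.HardSphereEuler
import HarnessLib

/-!
# Window energy, Poisson–Maxwell reference and good-set support — infinite-volume helpers for `RateFloor`

Support file of the crux `JParityClosure.RateFloor` (stmt-AtomisticToContinuum-13080), line
`stationary-limit-no-screening` (lead c7; wave-1 stub-workers on S3♭ `stub_finiteEntropyDynamics`, S3
`stub_stationaryLimit`, S4 `stub_functionalLimits`).  Everything here is stated in the TREE's vocabulary only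
(`PointConfig`, `windowSum`, `kineticEnergyDensity`, `IsTranslationInvariant`, `maxwellPhaseMeasure`,
`IsPoissonPointProcess`, `localGibbsLaw`, `HardSphereFlow.good`) — the line's own limit-object definitions are not
needed for these three facts, which are the def-free cores of the wave's Lean-checked audit lemmas:

* `lintegral_windowSum_ball_lt_top` (registered stub of the line, the core of S4's proved conjunct
  `idealRate < ⊤`): for a translation-invariant finite law `P` on configurations of `ℝ³ × ℝ³` with finite
  kinetic-energy density, the expected kinetic energy carried by the particles with position in ANY ball is finite —
  cover the ball by the `(2⌈L⌉+1)³` integer translates of the unit cube and move each cube to the origin by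
  translation invariance (`windowSum_cube_eq`, `exists_mem_cube`).
* `exists_poissonMaxwell_reference` (+ `isLocallyFiniteMeasure_maxwellPhaseMeasure`, `maxwellPhaseMeasure_singleton`):
  a Poisson point process with intensity `Leb ⊗ M₁(v)dv` on `ℝ³ × ℝ³` EXISTS (Kingman's theorem as proved in the tree,
  `existsUnique_isPoissonPointProcess_holds`), so entropy-density hypotheses quantified over "every Poisson–Maxwell
  reference law" are genuine constraints, not vacuous.
* `measure_compl_good_eq_zero_of_klDiv_ne_top`: a law of finite relative entropy with respect to a local Gibbs law of
  `N + 1` hard spheres is carried by the good set of the flow (`klDiv ≠ ⊤ ⇒ μ ≪ G_N = W·Liouville`, `Liouville(goodᶜ) = 0`)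
  — the first step of every honest push-forward of entropy-class laws along the flow.
-/

noncomputable section

open scoped BigOperators ENNReal
open MeasureTheory Set Filter Function
open Literature.Analysis.FunctionSpaces Literature.Analysis.FluidPDE Literature.MathematicalPhysics.KineticTheory

namespace Summit.AtomisticToContinuum.HydrodynamicLimit.Theorems.RateFloorStationaryWindowEnergy

/-! ## Kinetic energy in a ball: covering by integer translates of the unit cube -/

/-- The ball of radius `L` is covered by the cubes `[0,1)³ + k`, `k ∈ [-⌈L⌉, ⌈L⌉]³ ∩ ℤ³` (the cube `[0,1)³ + k` written
as the preimage of `Torus.unitCube (Fin 3)` under `x ↦ x − k`). [folklore] -/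
theorem exists_mem_cube {L : ℝ} {x : V3} (hx : x ∈ Metric.ball (0 : V3) L) :
    ∃ k ∈ Fintype.piFinset (fun _ : Fin 3 => Finset.Icc (-(⌈L⌉₊ : ℤ)) (⌈L⌉₊ : ℤ)),
      x - (WithLp.toLp 2 fun i => (k i : ℝ) : V3) ∈ Torus.unitCube (Fin 3) := by
  refine ⟨fun i => ⌊x i⌋, ?_, ?_⟩
  · rw [Fintype.mem_piFinset]
    intro i
    rw [Finset.mem_Icc]
    have hxi : |x i| ≤ ‖x‖ := by simpa only [Real.norm_eq_abs] using PiLp.norm_apply_le x i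
    have hxL : ‖x‖ < L := mem_ball_zero_iff.1 hx
    have hLc : L ≤ (⌈L⌉₊ : ℝ) := Nat.le_ceil L
    have habs := abs_le.1 (hxi.trans (hxL.le.trans hLc))
    constructor
    · have h1 : ((-(⌈L⌉₊ : ℤ) : ℤ) : ℝ) ≤ x i := by push_cast; exact habs.1
      have h2 := Int.floor_mono h1
      rwa [Int.floor_intCast] at h2
    · have h2 : (⌊x i⌋ : ℝ) ≤ (⌈L⌉₊ : ℝ) := (Int.floor_le _).trans habs.2
      exact_mod_cast h2
  · intro i
    rw [PiLp.sub_apply, PiLp.toLp_apply]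
    exact ⟨by linarith [Int.floor_le (x i)], by linarith [Int.lt_floor_add_one (x i)]⟩

/-- Window sums of a velocity functional over the translated cube `[0,1)³ + v` are window sums of the translated
configuration `ω − (v, 0)` over the unit cube. [folklore] -/
theorem windowSum_cube_eq (ω : PointConfig (V3 × V3)) (v : V3) (g : V3 → ℝ≥0∞) :
    windowSum ω ((fun x => x - v) ⁻¹' Torus.unitCube (Fin 3)) (fun p => g p.2) =
      windowSum (ω.translate (-v, 0)) (Torus.unitCube (Fin 3)) (fun p => g p.2) := by
  classical
  unfold windowSum
  rw [tsum_particlesIn_eq ω ((fun x => x - v) ⁻¹' Torus.unitCube (Fin 3)) (fun p => g p.2),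
    tsum_particlesIn_eq (ω.translate (-v, 0)) (Torus.unitCube (Fin 3)) (fun p => g p.2)]
  have hinj : Set.InjOn (fun p : V3 × V3 => p + (-v, 0)) (ω : Set (V3 × V3)) :=
    fun x _ y _ hxy => add_right_cancel hxy
  have hset : ((ω.translate (-v, 0) : PointConfig (V3 × V3)) : Set (V3 × V3)) =
      (fun p : V3 × V3 => p + (-v, 0)) '' (ω : Set (V3 × V3)) := rfl
  rw [hset, tsum_image _ hinj]
  refine tsum_congr fun p => ?_
  simp only [Set.indicator_apply, Set.mem_setOf_eq, Set.mem_preimage, Prod.fst_add, Prod.snd_add, add_zero,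
    sub_eq_add_neg]

/-- **Finite kinetic energy in balls**: for a translation-invariant finite law `P` on
configurations of `ℝ³ × ℝ³` with finite kinetic-energy density, the expected kinetic energy of the particles with
position in the ball of radius `L` is finite — at most `(2⌈L⌉+1)³ · kineticEnergyDensity P`. [folklore] -/
theorem lintegral_windowSum_ball_lt_top' {P : Measure (PointConfig (V3 × V3))} [IsFiniteMeasure P]
    (hTI : IsTranslationInvariant P) (hKE : kineticEnergyDensity P < ⊤) (L : ℝ) :
    ∫⁻ ω, windowSum ω (Metric.ball (0 : V3) L) (fun p => ENNReal.ofReal (‖p.2‖ ^ 2 / 2)) ∂P < ⊤ := by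
  classical
  set F : V3 × V3 → ℝ≥0∞ := fun p => ENNReal.ofReal (‖p.2‖ ^ 2 / 2) with hF
  set K := Fintype.piFinset (fun _ : Fin 3 => Finset.Icc (-(⌈L⌉₊ : ℤ)) (⌈L⌉₊ : ℤ)) with hK
  -- the cube `[0,1)³ + k`
  let cube : (Fin 3 → ℤ) → Set V3 := fun k =>
    (fun x => x - (WithLp.toLp 2 fun i => (k i : ℝ) : V3)) ⁻¹' Torus.unitCube (Fin 3)
  have hcubeM : ∀ k, MeasurableSet (cube k) := fun k =>
    (measurable_id.sub measurable_const) Torus.measurableSet_unitCube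
  have hfm : Measurable F := measurable_kineticIntegrand
  -- pointwise covering bound
  have hpt : ∀ ω : PointConfig (V3 × V3),
      windowSum ω (Metric.ball (0 : V3) L) F ≤ ∑ k ∈ K, windowSum ω (cube k) F := by
    intro ω
    unfold windowSum
    simp_rw [tsum_particlesIn_eq]
    rw [← Summable.tsum_finsetSum (fun _ _ => ENNReal.summable)]
    refine ENNReal.tsum_le_tsum fun p => ?_
    by_cases hp : (p : V3 × V3).1 ∈ Metric.ball (0 : V3) L
    · obtain ⟨k, hk, hmem⟩ := exists_mem_cube hp
      rw [Set.indicator_of_mem (show (p : V3 × V3) ∈ {q : V3 × V3 | q.1 ∈ Metric.ball (0 : V3) L} from hp)]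
      refine le_trans ?_ (Finset.single_le_sum
        (f := fun k => {q : V3 × V3 | q.1 ∈ cube k}.indicator F p) (fun _ _ => bot_le) hk)
      rw [Set.indicator_of_mem (show (p : V3 × V3) ∈ {q : V3 × V3 | q.1 ∈ cube k} from hmem)]
    · rw [Set.indicator_of_notMem (show (p : V3 × V3) ∉ {q : V3 × V3 | q.1 ∈ Metric.ball (0 : V3) L} from hp)]
      exact bot_le
  -- each cube carries exactly the kinetic energy density
  have hcube : ∀ k : Fin 3 → ℤ, ∫⁻ ω, windowSum ω (cube k) F ∂P = kineticEnergyDensity P := by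
    intro k
    have h1 : ∫⁻ ω, windowSum ω (cube k) F ∂P =
        ∫⁻ ω, windowSum (ω.translate (-(WithLp.toLp 2 fun i => (k i : ℝ) : V3), 0)) (Torus.unitCube (Fin 3)) F ∂P :=
      lintegral_congr fun ω => windowSum_cube_eq ω _ (fun v => ENNReal.ofReal (‖v‖ ^ 2 / 2))
    have h2 := lintegral_map (μ := P) (f := fun ω : PointConfig (V3 × V3) => windowSum ω (Torus.unitCube (Fin 3)) F)
      (measurable_windowSum Torus.measurableSet_unitCube hfm)
      (PointConfig.measurable_translate (-(WithLp.toLp 2 fun i => (k i : ℝ) : V3), 0))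
    rw [h1, ← h2, hTI (-(WithLp.toLp 2 fun i => (k i : ℝ) : V3))]
    rfl
  calc ∫⁻ ω, windowSum ω (Metric.ball (0 : V3) L) F ∂P
      ≤ ∫⁻ ω, ∑ k ∈ K, windowSum ω (cube k) F ∂P := lintegral_mono fun ω => hpt ω
    _ = ∑ k ∈ K, ∫⁻ ω, windowSum ω (cube k) F ∂P :=
        lintegral_finsetSum _ fun k _ => measurable_windowSum (hcubeM k) hfm
    _ = ∑ k ∈ K, kineticEnergyDensity P := Finset.sum_congr rfl fun k _ => hcube k
    _ < ⊤ := by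
        rw [Finset.sum_const, nsmul_eq_mul]
        exact ENNReal.mul_lt_top (by simp) hKE

/-- **Finite kinetic energy in balls**, registered form (helper stub `lintegral_windowSum_ball_lt_top` of the crux item;
the `∀`-spelling of `lintegral_windowSum_ball_lt_top'`). [folklore] -/
theorem lintegral_windowSum_ball_lt_top : ∀ {P : Measure (PointConfig (V3 × V3))} [IsFiniteMeasure P], IsTranslationInvariant P → kineticEnergyDensity P < ⊤ → ∀ L : ℝ, ∫⁻ ω, windowSum ω (Metric.ball (0 : V3) L) (fun p => ENNReal.ofReal (‖p.2‖ ^ 2 / 2)) ∂P < ⊤ :=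
  fun hTI hKE L => lintegral_windowSum_ball_lt_top' hTI hKE L

/-! ## The Poisson–Maxwell reference law exists -/

/-- The Poisson–Maxwell intensity `Leb ⊗ M₁(v)dv` on `ℝ³ × ℝ³` is locally finite. [folklore] -/
theorem isLocallyFiniteMeasure_maxwellPhaseMeasure :
    IsLocallyFiniteMeasure (maxwellPhaseMeasure (1 : ℝ) (0 : V3) (Set.univ : Set V3)) := by
  unfold maxwellPhaseMeasure
  have hc : Continuous (maxwellianBeta (d := Fin 3) 1) := by
    rw [maxwellianBeta_one]; exact continuous_globalMaxwellian
  haveI : IsLocallyFiniteMeasure ((volume : Measure V3).withDensity fun v =>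
      ENNReal.ofReal (maxwellianBeta 1 (v - 0))) :=
    IsLocallyFiniteMeasure.withDensity_ofReal (hc.comp (continuous_id.sub continuous_const))
  infer_instance

/-- The Poisson–Maxwell intensity has no atoms. [folklore] -/
theorem maxwellPhaseMeasure_singleton (x : V3 × V3) :
    maxwellPhaseMeasure (1 : ℝ) (0 : V3) (Set.univ : Set V3) {x} = 0 := by
  unfold maxwellPhaseMeasure
  rw [← Set.singleton_prod_singleton, Measure.prod_prod, Measure.restrict_univ, measure_singleton, zero_mul]

/-- **A Poisson–Maxwell reference law exists** on configurations of `ℝ³ × ℝ³` (Kingman's existence theorem as proved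
in the tree, `existsUnique_isPoissonPointProcess_holds`, for the locally finite atomless intensity `Leb ⊗ M₁(v)dv`):
entropy-density hypotheses of the form "for every Poisson–Maxwell reference law `Pref`, `KL(P_L ‖ Pref_L) ≤ h·L³`" are
therefore genuine constraints on `P`, never `∀ Pref ∈ ∅`. [folklore] -/
theorem exists_poissonMaxwell_reference :
    ∃ Pref : Measure (PointConfig (V3 × V3)),
      IsPoissonPointProcess (maxwellPhaseMeasure (1 : ℝ) (0 : V3) Set.univ) Pref := by
  haveI := isLocallyFiniteMeasure_maxwellPhaseMeasure
  exact (existsUnique_isPoissonPointProcess_holds (E := V3 × V3) _ maxwellPhaseMeasure_singleton).exists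

/-! ## Entropy-class laws are carried by the good set of the flow -/

/-- A law of finite relative entropy with respect to a local Gibbs law of `N + 1` hard spheres is carried by the good
set of the flow: `klDiv μ G ≠ ⊤ ⇒ μ ≪ G = W·Liouville ≪ Liouville` and `Liouville (goodᶜ) = 0`. [folklore] -/
theorem measure_compl_good_eq_zero_of_klDiv_ne_top {σ : ℝ} {N : ℕ}
    (Φ : HardSphereFlow (Torus.geometry (Fin 3)) (hsDiameter σ N) (N + 1))
    (a₀ : T3 → ℝ) (u₀ : T3 → V3) (θ₀ : T3 → ℝ) {μ : Measure (Config (N + 1) (Fin 3) T3)}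
    (h : InformationTheory.klDiv μ (localGibbsLaw σ a₀ u₀ θ₀ N Φ) ≠ ⊤) : μ Φ.goodᶜ = 0 := by
  have hac : μ ≪ localGibbsLaw σ a₀ u₀ θ₀ N Φ := (InformationTheory.klDiv_ne_top_iff.1 h).1
  refine hac ?_
  show particleLaw Φ _ Φ.goodᶜ = 0
  rw [particleLaw_eq]
  exact withDensity_absolutelyContinuous _ _ Φ.measure_compl_good

end Summit.AtomisticToContinuum.HydrodynamicLimit.Theorems.RateFloorStationaryWindowEnergy

end
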